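import Literature.AlgebraicGeometry.HodgeTheory.QuaternionicQuarticFermatMember
import Literature.AlgebraicGeometry.Surfaces.HirzebruchTwoChartBounds
import HarnessLib

/-!
# The Fermat member: its branch curve in the four charts of `𝔽₂` (closed forms and support bounds)

Layer `Literature/AlgebraicGeometry/HodgeTheory`, namespace `Literature.AlgebraicGeometry.HodgeTheory.Q8Family`. Theorems only (no
definition, no named fact). Written by the prover seat `leafhand-hodge-q8symplecticpowers-4` (g5, cell `pub-hsemireg`) for target
(T2) of memo NINTH-HAND-S1-DESIGN-leafhand4-g5 (route `HodgeConjecture/Q8SymplecticPowers`, crux K1Q, stmt-HodgeConjecture-24190,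
stub S1; consumer: hypothesis `hNod` of `Q8SymplecticPowersRegularOfNodalBranchCurve.stub_regularVeryGeneralQ_of_nodalDoubleCoverFact`
at the explicit member `fermatParam e`, data `α = e`, `N = 1`).

With `G₂ = (s³ − s)·y·Ψ₂`, `Ψ₂ = (s²y − 2)^d + (y − 2)^d + 1`, `d = e − 1` (`QuaternionicQuarticFermatMember`), the chart calculus
of `HirzebruchTwoChartCalculus` ∕ `…ChartBounds` gives (all for `e ≥ 1`):
* support bounds (first clause of `IsChartExact e 1 G₂`): every monomial `sⁱyʲ` of `G₂` has `j ≤ e` and `i ≤ 1 + 2j`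
  (`yBound_planeG₂_fermatParam`, `poleBound_planeG₂_fermatParam`);
* chart `U₃ = (s, v = 1/y)`: `chartThree e G₂ = (s³ − s) · Φ₃`, `Φ₃ = (s² − 2v)^d + (1 − 2v)^d + v^d` (`chartThree_planeG₂_fermatParam`);
* chart `U₂ = (s′, y′)` (with the branched fibre `f_∞ = {s′ = 0}`, `N = 1` odd): `s′ · chartTwo 1 G₂ = −G₂(s′, y′)` — the SAME curve
  (the `σ`-symmetry `u₀ ↔ u₁` of the member) (`X_mul_chartTwo_planeG₂_fermatParam`);
* chart `U₄ = (s′, v′)`: `s′ · chartFour e 1 G₂ = −(chartThree e G₂)(s′, v′)` (`X_mul_chartFour_planeG₂_fermatParam`).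
Hence nodality in all four charts reduces to the two affine curves `G₂ = 0` (done: `…FermatMemberChartOne`) and `(s³ − s)·Φ₃ = 0`
(sequel). Honest scope: explicit algebra; nothing here bears on HC; S1 ∕ K1Q NOT proved here.

References: [Hartshorne1977] V.2 (ruled surfaces `𝔽ₑ`); [Zariski1929]; [Naie2007] §1.2.
-/

noncomputable section

open MvPolynomial
open Literature.AlgebraicGeometry.Surfaces.HirzebruchTwoDoublePlane

namespace Literature.AlgebraicGeometry.HodgeTheory.Q8Family

/-! ### The two factors `(s³ − s)·y` and `Ψ₂` as explicit polynomials -/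

/-- `(s³ − s)·y = s³y − sy` as a difference of monomials. [folklore] -/
private theorem cubicY_eq :
    (X 0 * (X 0 - 1) * (X 0 + 1) * X 1 : MvPolynomial (Fin 2) ℂ) =
      monomial (Finsupp.single 0 3 + Finsupp.single 1 1) 1 - monomial (Finsupp.single 0 1 + Finsupp.single 1 1) 1 := by
  have h3 : (monomial (Finsupp.single 0 3 + Finsupp.single 1 1) 1 : MvPolynomial (Fin 2) ℂ) = X 0 ^ 3 * X 1 := by
    rw [X_pow_eq_monomial, X, monomial_mul, mul_one]
  have h1 : (monomial (Finsupp.single 0 1 + Finsupp.single 1 1) 1 : MvPolynomial (Fin 2) ℂ) = X 0 * X 1 := by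
    rw [X, X, monomial_mul, mul_one]
  rw [h3, h1]
  ring

/-- Congruence of `monomial` in the exponent (plumbing). [folklore] -/
private theorem monomial_congr_exp {m m' : Fin 2 →₀ ℕ} (c : ℂ) (h : m = m') :
    (monomial m c : MvPolynomial (Fin 2) ℂ) = monomial m' c := by rw [h]

/-- `s²y` as a monomial. [folklore] -/
private theorem sqY_eq :
    (X 0 ^ 2 * X 1 : MvPolynomial (Fin 2) ℂ) = monomial (Finsupp.single 0 2 + Finsupp.single 1 1) 1 := by
  rw [X_pow_eq_monomial, X, monomial_mul, mul_one]

/-- `deg_y ((s³ − s)y) ≤ 1`. [cite: Hartshorne1977, V.2 (ruled surfaces)] -/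
theorem yBound_cubicY : ∀ m ∈ (X 0 * (X 0 - 1) * (X 0 + 1) * X 1 : MvPolynomial (Fin 2) ℂ).support, m 1 ≤ 1 := by
  rw [cubicY_eq]
  exact yBound_sub (fun m hm => by simpa using yBound_monomial _ 1 m hm) (fun m hm => by simpa using yBound_monomial _ 1 m hm)

/-- Pole bound `1` for `(s³ − s)y` (monomials `s³y`, `sy`: `3 ≤ 1 + 2`, `1 ≤ 1 + 2`). [cite: Hartshorne1977, V.2 (ruled surfaces)] -/
theorem poleBound_cubicY :
    ∀ m ∈ (X 0 * (X 0 - 1) * (X 0 + 1) * X 1 : MvPolynomial (Fin 2) ℂ).support, m 0 ≤ 1 + 2 * m 1 := by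
  rw [cubicY_eq]
  exact poleBound_sub (poleBound_monomial _ 1 (by simp)) (poleBound_monomial _ 1 (by simp))

/-- `deg_y (s²y − 2) ≤ 1`. [cite: Hartshorne1977, V.2 (ruled surfaces)] -/
theorem yBound_sqY_sub_two : ∀ m ∈ (X 0 ^ 2 * X 1 - C 2 : MvPolynomial (Fin 2) ℂ).support, m 1 ≤ 1 := by
  rw [sqY_eq]
  exact yBound_sub (fun m hm => by simpa using yBound_monomial _ 1 m hm) (yBound_mono (by norm_num) (yBound_C 2))

/-- Pole bound `0` for `s²y − 2` (`2 ≤ 0 + 2`). [cite: Hartshorne1977, V.2 (ruled surfaces)] -/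
theorem poleBound_sqY_sub_two : ∀ m ∈ (X 0 ^ 2 * X 1 - C 2 : MvPolynomial (Fin 2) ℂ).support, m 0 ≤ 0 + 2 * m 1 := by
  rw [sqY_eq]
  exact poleBound_sub (poleBound_monomial _ 1 (by simp)) (poleBound_C 2)

/-- `deg_y (y − 2) ≤ 1`. [cite: Hartshorne1977, V.2 (ruled surfaces)] -/
theorem yBound_Y_sub_two : ∀ m ∈ (X 1 - C 2 : MvPolynomial (Fin 2) ℂ).support, m 1 ≤ 1 :=
  yBound_sub yBound_X_one (yBound_mono (by norm_num) (yBound_C 2))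

/-- Pole bound `0` for `y − 2`. [cite: Hartshorne1977, V.2 (ruled surfaces)] -/
theorem poleBound_Y_sub_two : ∀ m ∈ (X 1 - C 2 : MvPolynomial (Fin 2) ℂ).support, m 0 ≤ 0 + 2 * m 1 :=
  poleBound_sub poleBound_X_one (poleBound_C 2)

/-- `deg_y Ψ₂ ≤ e − 1`. [cite: Hartshorne1977, V.2 (ruled surfaces)] -/
theorem yBound_planeΨ₂_fermatParam (e : ℕ) : ∀ m ∈ (planeΨ₂ (fermatParam e) 1).support, m 1 ≤ e - 1 := by
  rw [planeΨ₂_fermatParam]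
  refine yBound_add (yBound_add ?_ ?_) (by rw [← C_1]; exact yBound_mono (Nat.zero_le _) (yBound_C 1))
  · simpa using yBound_pow yBound_sqY_sub_two (e - 1)
  · simpa using yBound_pow yBound_Y_sub_two (e - 1)

/-- Pole bound `0` for `Ψ₂`. [cite: Hartshorne1977, V.2 (ruled surfaces)] -/
theorem poleBound_planeΨ₂_fermatParam (e : ℕ) : ∀ m ∈ (planeΨ₂ (fermatParam e) 1).support, m 0 ≤ 0 + 2 * m 1 := by
  rw [planeΨ₂_fermatParam]
  refine poleBound_add (poleBound_add ?_ ?_) (by rw [← C_1]; exact poleBound_C 1)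
  · simpa using poleBound_pow poleBound_sqY_sub_two (e - 1)
  · simpa using poleBound_pow poleBound_Y_sub_two (e - 1)

/-- **Support bounds of `G₂`** (first clause of `IsChartExact e 1 G₂`): `deg_y ≤ e` and pole order `≤ 1`, for `e ≥ 1`.
[cite: Hartshorne1977, V.2 (ruled surfaces)] -/
theorem bounds_planeG₂_fermatParam {e : ℕ} (he : 1 ≤ e) :
    ∀ m ∈ (planeG₂ (fermatParam e) 1).support, m 1 ≤ e ∧ m 0 ≤ 1 + 2 * m 1 := by
  intro m hm
  rw [planeG₂_fermatParam_factor, ← planeΨ₂_fermatParam] at hm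
  refine ⟨?_, ?_⟩
  · have h := yBound_mul yBound_cubicY (yBound_planeΨ₂_fermatParam e) m hm
    omega
  · have h := poleBound_mul poleBound_cubicY (poleBound_planeΨ₂_fermatParam e) m hm
    omega

/-! ### Chart `U₃ = (s, v = 1/y)` -/

/-- `chartThree 1 ((s³ − s)y) = s³ − s`. [cite: Hartshorne1977, V.2 (ruled surfaces)] -/
theorem chartThree_cubicY : chartThree 1 (X 0 * (X 0 - 1) * (X 0 + 1) * X 1 : MvPolynomial (Fin 2) ℂ) = X 0 ^ 3 - X 0 := by
  rw [cubicY_eq, chartThree_sub, chartThree_monomial, chartThree_monomial, X_pow_eq_monomial, X]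
  exact congrArg₂ (· - ·) (monomial_congr_exp 1 (by ext i; fin_cases i <;> simp))
    (monomial_congr_exp 1 (by ext i; fin_cases i <;> simp))

/-- `chartThree 1 (s²y − 2) = s² − 2v`. [cite: Hartshorne1977, V.2 (ruled surfaces)] -/
theorem chartThree_sqY_sub_two : chartThree 1 (X 0 ^ 2 * X 1 - C 2 : MvPolynomial (Fin 2) ℂ) = X 0 ^ 2 - C 2 * X 1 := by
  rw [chartThree_sub, sqY_eq, chartThree_monomial, chartThree_C, pow_one, X_pow_eq_monomial]
  exact congrArg₂ (· - ·) (monomial_congr_exp 1 (by ext i; fin_cases i <;> simp)) rfl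

/-- `chartThree 1 (y − 2) = 1 − 2v`. [cite: Hartshorne1977, V.2 (ruled surfaces)] -/
theorem chartThree_Y_sub_two : chartThree 1 (X 1 - C 2 : MvPolynomial (Fin 2) ℂ) = 1 - C 2 * X 1 := by
  rw [chartThree_sub, chartThree_X_one, chartThree_C, pow_one]
  simp

/-- `chartThree d Ψ₂ = Φ₃ := (s² − 2v)^d + (1 − 2v)^d + v^d`. [cite: Hartshorne1977, V.2 (ruled surfaces)] -/
theorem chartThree_planeΨ₂_fermatParam (e : ℕ) :
    chartThree (e - 1) (planeΨ₂ (fermatParam e) 1) =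
      (X 0 ^ 2 - C 2 * X 1) ^ (e - 1) + (1 - C 2 * X 1) ^ (e - 1) + X 1 ^ (e - 1) := by
  rw [planeΨ₂_fermatParam, chartThree_add, chartThree_add]
  have h1 := chartThree_pow yBound_sqY_sub_two (e - 1)
  have h2 := chartThree_pow yBound_Y_sub_two (e - 1)
  rw [mul_one] at h1 h2
  rw [h1, h2, chartThree_sqY_sub_two, chartThree_Y_sub_two, ← C_1, chartThree_C, map_one, one_mul]

/-- **Chart `U₃`: `chartThree e G₂ = (s³ − s) · Φ₃`** for `e ≥ 1`. [cite: Hartshorne1977, V.2 (ruled surfaces)] -/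
theorem chartThree_planeG₂_fermatParam {e : ℕ} (he : 1 ≤ e) :
    chartThree e (planeG₂ (fermatParam e) 1) =
      (X 0 ^ 3 - X 0) * ((X 0 ^ 2 - C 2 * X 1) ^ (e - 1) + (1 - C 2 * X 1) ^ (e - 1) + X 1 ^ (e - 1)) := by
  rw [planeG₂_fermatParam_factor, ← planeΨ₂_fermatParam]
  have hsplit : e = 1 + (e - 1) := by omega
  have h := chartThree_mul (α₁ := 1) (α₂ := e - 1) yBound_cubicY (yBound_planeΨ₂_fermatParam e)
  rw [← hsplit] at h
  rw [h, chartThree_cubicY, chartThree_planeΨ₂_fermatParam]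

/-! ### Chart `U₂ = (s′, y′)`: the same curve -/

/-- `chartTwo 1 ((s³ − s)y) = y′ − s′²y′`. [cite: Hartshorne1977, V.2 (ruled surfaces)] -/
theorem chartTwo_cubicY : chartTwo 1 (X 0 * (X 0 - 1) * (X 0 + 1) * X 1 : MvPolynomial (Fin 2) ℂ) = X 1 - X 0 ^ 2 * X 1 := by
  rw [cubicY_eq, chartTwo_sub, chartTwo_monomial, chartTwo_monomial, sqY_eq, X]
  exact congrArg₂ (· - ·) (monomial_congr_exp 1 (by ext i; fin_cases i <;> simp))
    (monomial_congr_exp 1 (by ext i; fin_cases i <;> simp))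

/-- `chartTwo 0 (s²y − 2) = y′ − 2`. [cite: Hartshorne1977, V.2 (ruled surfaces)] -/
theorem chartTwo_sqY_sub_two : chartTwo 0 (X 0 ^ 2 * X 1 - C 2 : MvPolynomial (Fin 2) ℂ) = X 1 - C 2 := by
  rw [chartTwo_sub, sqY_eq, chartTwo_monomial, chartTwo_C, pow_zero, mul_one, X]
  exact congrArg₂ (· - ·) (monomial_congr_exp 1 (by ext i; fin_cases i <;> simp)) rfl

/-- `chartTwo 0 (y − 2) = s′²y′ − 2`. [cite: Hartshorne1977, V.2 (ruled surfaces)] -/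
theorem chartTwo_Y_sub_two : chartTwo 0 (X 1 - C 2 : MvPolynomial (Fin 2) ℂ) = X 0 ^ 2 * X 1 - C 2 := by
  rw [chartTwo_sub, chartTwo_X_one, chartTwo_C, pow_zero, mul_one]

/-- `chartTwo 0 Ψ₂ = (y′ − 2)^d + (s′²y′ − 2)^d + 1`. [cite: Hartshorne1977, V.2 (ruled surfaces)] -/
theorem chartTwo_planeΨ₂_fermatParam (e : ℕ) :
    chartTwo 0 (planeΨ₂ (fermatParam e) 1) = (X 1 - C 2) ^ (e - 1) + (X 0 ^ 2 * X 1 - C 2) ^ (e - 1) + 1 := by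
  rw [planeΨ₂_fermatParam, chartTwo_add, chartTwo_add]
  have h1 := chartTwo_pow poleBound_sqY_sub_two (e - 1)
  have h2 := chartTwo_pow poleBound_Y_sub_two (e - 1)
  rw [mul_zero] at h1 h2
  rw [h1, h2, chartTwo_sqY_sub_two, chartTwo_Y_sub_two, ← C_1, chartTwo_C, pow_zero, mul_one]

/-- **Chart `U₂`: `s′ · chartTwo 1 G₂ = −G₂(s′, y′)`** — with the branched fibre `f_∞ = {s′ = 0}` thrown in, the chart-`U₂` branch
curve is the chart-`U₁` curve again (the member is `σ`-symmetric), for `e ≥ 1`. [cite: Hartshorne1977, V.2 (ruled surfaces)] -/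
theorem X_mul_chartTwo_planeG₂_fermatParam (e : ℕ) :
    X 0 ^ (1 % 2) * chartTwo 1 (planeG₂ (fermatParam e) 1) = C (-1) * planeG₂ (fermatParam e) 1 := by
  rw [planeG₂_fermatParam_factor, ← planeΨ₂_fermatParam]
  have h := chartTwo_mul (N₁ := 1) (N₂ := 0) poleBound_cubicY (poleBound_planeΨ₂_fermatParam e)
  rw [Nat.add_zero] at h
  simp only [Nat.reduceMod, pow_one]
  rw [h, chartTwo_cubicY, chartTwo_planeΨ₂_fermatParam, planeΨ₂_fermatParam]
  simp only [map_neg, map_one]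
  ring

/-! ### Chart `U₄ = (s′, v′)`: the chart-`U₃` curve again -/

/-- `chartFour 1 1 ((s³ − s)y) = 1 − s′²`. [cite: Hartshorne1977, V.2 (ruled surfaces)] -/
theorem chartFour_cubicY : chartFour 1 1 (X 0 * (X 0 - 1) * (X 0 + 1) * X 1 : MvPolynomial (Fin 2) ℂ) = 1 - X 0 ^ 2 := by
  rw [cubicY_eq, chartFour_sub, chartFour_monomial, chartFour_monomial, X_pow_eq_monomial, ← C_1, C_apply]
  exact congrArg₂ (· - ·) (monomial_congr_exp 1 (by ext i; fin_cases i <;> simp))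
    (monomial_congr_exp 1 (by ext i; fin_cases i <;> simp))

/-- `chartFour 1 0 (s²y − 2) = 1 − 2v′`. [cite: Hartshorne1977, V.2 (ruled surfaces)] -/
theorem chartFour_sqY_sub_two : chartFour 1 0 (X 0 ^ 2 * X 1 - C 2 : MvPolynomial (Fin 2) ℂ) = 1 - C 2 * X 1 := by
  rw [chartFour_sub, sqY_eq, chartFour_monomial, chartFour_C, pow_zero, pow_one, one_mul, ← C_1, C_apply]
  exact congrArg₂ (· - ·) (monomial_congr_exp 1 (by ext i; fin_cases i <;> simp)) rfl

/-- `chartFour 1 0 (y − 2) = s′² − 2v′`. [cite: Hartshorne1977, V.2 (ruled surfaces)] -/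
theorem chartFour_Y_sub_two : chartFour 1 0 (X 1 - C 2 : MvPolynomial (Fin 2) ℂ) = X 0 ^ 2 - C 2 * X 1 := by
  rw [chartFour_sub, chartFour_X_one, chartFour_C, pow_zero, pow_zero, pow_one, mul_one, one_mul]

/-- `chartFour d 0 Ψ₂ = (1 − 2v′)^d + (s′² − 2v′)^d + v′^d`. [cite: Hartshorne1977, V.2 (ruled surfaces)] -/
theorem chartFour_planeΨ₂_fermatParam (e : ℕ) :
    chartFour (e - 1) 0 (planeΨ₂ (fermatParam e) 1) =
      (1 - C 2 * X 1) ^ (e - 1) + (X 0 ^ 2 - C 2 * X 1) ^ (e - 1) + X 1 ^ (e - 1) := by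
  rw [planeΨ₂_fermatParam, chartFour_add, chartFour_add]
  have h1 := chartFour_pow (fun m hm => ⟨yBound_sqY_sub_two m hm, poleBound_sqY_sub_two m hm⟩) (e - 1)
  have h2 := chartFour_pow (fun m hm => ⟨yBound_Y_sub_two m hm, poleBound_Y_sub_two m hm⟩) (e - 1)
  rw [mul_one, mul_zero] at h1 h2
  rw [h1, h2, chartFour_sqY_sub_two, chartFour_Y_sub_two, ← C_1, chartFour_C, pow_zero, one_mul, map_one, one_mul]

/-- **Chart `U₄`: `s′ · chartFour e 1 G₂ = −(chartThree e G₂)(s′, v′)`** for `e ≥ 1`. [cite: Hartshorne1977, V.2 (ruled surfaces)] -/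
theorem X_mul_chartFour_planeG₂_fermatParam {e : ℕ} (he : 1 ≤ e) :
    X 0 ^ (1 % 2) * chartFour e 1 (planeG₂ (fermatParam e) 1) = C (-1) * chartThree e (planeG₂ (fermatParam e) 1) := by
  rw [chartThree_planeG₂_fermatParam he, planeG₂_fermatParam_factor, ← planeΨ₂_fermatParam]
  have hsplit : e = 1 + (e - 1) := by omega
  have hb : ∀ m ∈ (X 0 * (X 0 - 1) * (X 0 + 1) * X 1 : MvPolynomial (Fin 2) ℂ).support, m 1 ≤ 1 ∧ m 0 ≤ 1 + 2 * m 1 :=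
    fun m hm => ⟨yBound_cubicY m hm, poleBound_cubicY m hm⟩
  have hb' : ∀ m ∈ (planeΨ₂ (fermatParam e) 1).support, m 1 ≤ e - 1 ∧ m 0 ≤ 0 + 2 * m 1 :=
    fun m hm => ⟨yBound_planeΨ₂_fermatParam e m hm, poleBound_planeΨ₂_fermatParam e m hm⟩
  have h := chartFour_mul (α₁ := 1) (α₂ := e - 1) (N₁ := 1) (N₂ := 0) hb hb'
  rw [← hsplit, Nat.add_zero] at h
  simp only [Nat.reduceMod, pow_one]
  rw [h, chartFour_cubicY, chartFour_planeΨ₂_fermatParam]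
  simp only [map_neg, map_one]
  ring

end Literature.AlgebraicGeometry.HodgeTheory.Q8Family

end
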